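import Literature.NumberTheory.LFunctions.ExceptionalZeroPrimeSums
import Literature.NumberTheory.LFunctions.SiegelZeroExceptionalPrimesProofs
import Literature.NumberTheory.LFunctions.PrimitiveQuadraticCharacter
import HarnessLib

/-!
# Proof of `TaoTeravainen2021_prop35` (Tao–Teräväinen 2022, Proposition 3.5, first bound, for
# square-free conductors `q ≡ 3 (mod 4)` and the Jacobi symbol)

Topic `Literature/NumberTheory/LFunctions`, namespace `SiegelZero`. This file DISCHARGES the named
fact `Literature.NumberTheory.LFunctions.SiegelZero.TaoTeravainen2021_prop35` of
`ExceptionalZeroPrimeSums.lean`: `TaoTeravainen2021_prop35_holds`.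

The general-conductor form of the same bound, `SiegelZero.TaoTeravainen2021_eq313`
(`SiegelZeroExceptionalPrimes.lean`), is proved in `SiegelZeroExceptionalPrimesProofs.lean`
(`TaoTeravainen2021_eq313_holds`) from the tree's Siegel theorem, Pólya–Vinogradov mean value of
`∑ (1∗χ)(n)/n`, the comparison `L'(1,χ) ≍ L(1,χ) η log q` and the multiplicativity of `1∗χ`.
The present statement is its specialisation to square-free `q ≡ 3 (mod 4)`, where the primitive
quadratic character mod `q` IS the Jacobi symbol `(·/q)`
(`Literature.NumberTheory.LFunctions.PrimitiveQuadratic.apply_natCast_eq_jacobiSym`, design note 1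
of `ExceptionalZeroPrimeSums.lean`), so that "`p*` exceptional" (`χ(p*) ≠ -1`) reads
`(p*/q) ≠ -1`, and a prime `p` satisfies `q^{(1+ε)/2} < p ≤ x` iff `⌊q^{(1+ε)/2}⌋ < p ≤ ⌊x⌋`.

## References

* T. Tao, J. Teräväinen, *The Hardy–Littlewood–Chowla conjecture in the presence of a Siegel
  zero*, J. London Math. Soc. (2) 106 (2022), Proposition 3.5 (3.13). [TaoTeravainen2021]
-/

noncomputable section

open Finset

namespace Literature.NumberTheory.LFunctions.SiegelZero

/-- For an odd square-free `q` and the primitive quadratic `χ` mod `q`, the exceptional primes of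
`χ` in `(y, x]` (`y ≥ 0`) are the primes `p ≤ ⌊x⌋` with `y < p` and `(p/q) ≠ -1`. [folklore] -/
theorem filter_primesLE_eq_excPrimes {q : ℕ} [NeZero q] (hodd : Odd q) (hsq : Squarefree q)
    (χ : DirichletCharacter ℂ q) (hprim : χ.IsPrimitive) (hquad : χ.IsQuadratic) {y : ℝ}
    (hy : 0 ≤ y) (X : ℕ) :
    (Nat.primesLE X).filter (fun p : ℕ => y < (p : ℝ) ∧ jacobiSym (p : ℤ) q ≠ -1) =
      excPrimes χ (Ioc ⌊y⌋₊ X) := by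
  ext p
  rw [Finset.mem_filter, Nat.mem_primesLE, mem_excPrimes, Finset.mem_Ioc, Nat.floor_lt hy,
    PrimitiveQuadratic.apply_natCast_eq_jacobiSym hodd hsq χ hprim hquad p]
  constructor
  · rintro ⟨⟨hpx, hp⟩, hlt, hJ⟩
    exact ⟨⟨hlt, hpx⟩, hp, by exact_mod_cast hJ⟩
  · rintro ⟨⟨hlt, hpx⟩, hp, hJ⟩
    exact ⟨⟨hpx, hp⟩, hlt, by exact_mod_cast hJ⟩

/-- **Tao–Teräväinen 2022, Proposition 3.5, first bound — discharged** (the named fact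
`TaoTeravainen2021_prop35`: square-free `q ≡ 3 (mod 4)`, exceptional primes `(p/q) ≠ -1`): for
every `ε > 0` there are `K, η₀, q₀` such that for all such `q ≥ q₀`, every primitive quadratic `χ`
mod `q`, every `η ≥ η₀` with `L(1 − 1/(η log q), χ) = 0` and every `x ≥ q^{(1+ε)/2}`,
`∑_{q^{(1+ε)/2} < p ≤ x, (p/q) ≠ −1} 1/p ≤ K (log x / log q)/η`. Immediate from the
general-conductor form `TaoTeravainen2021_eq313_holds` and `χ = (·/q)`.
[cite: TaoTeravainen2021, Proposition 3.5 (3.13)] -/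
theorem TaoTeravainen2021_prop35_holds : TaoTeravainen2021_prop35 := by
  intro ε hε
  obtain ⟨K, η₀, h⟩ := TaoTeravainen2021_eq313_holds ε hε
  refine ⟨K, η₀, 0, ?_⟩
  intro q _ hsf hmod _ χ hprim hquad η hη hzero x hx
  have hodd : Odd q := Nat.odd_iff.mpr (by omega)
  have hyr0 : 0 ≤ (q : ℝ) ^ ((1 + ε) / 2) := by positivity
  rw [filter_primesLE_eq_excPrimes hodd hsf χ hprim hquad hyr0]
  exact h q χ hprim hquad η hη hzero x hx

end Literature.NumberTheory.LFunctions.SiegelZero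

end
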